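import Summits.FinalStateConjecture.FinalStateConjecture.Theorems.PhotonSphereChannelsEndVisibleOuterRegion
import HarnessLib

/-!
# Crux `DriftCapture` (stmt-FinalStateConjecture-17391, route RenormalisedDrift) · line `registered` · stub CENSOR-N
# `stub_noHiddenCompleteRays`: NoHidden is NECESSARY for clause (C) on every witness the end can see

The v9 skeleton of the crux (`Cruxes/DriftCapture/Lines/birth.lean`) derives CENSOR (= the shared item
stmt-FinalStateConjecture-17673 `SettledExteriorHoldsRays`: clause (C) `RaysStayInClosure 𝒟 O` for every honest
`O = exteriorOf 𝒟 fd.charted`) from S `stub_chartsShadowEndVisibleRegion` (chart side) and N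
`stub_noHiddenCompleteRays` (interior side: `EndVisible.CompleteRaysNearEndVisible 𝒟`). The landed material gives
`S ∧ N ⇒ CENSOR` pointwise and `CENSOR ⇒ S` (`DarkFuture.endVisibleShadow_of_settledExteriorHoldsRays`). This file
records the remaining direction, i.e. that N is not an artefact of the split but a NECESSARY condition for clause (C)
on every witness region the asymptotically flat end can see:

* §1 `chronologicalPast_closure_subset_chronologicalPast` (`I⁻(closure V) ⊆ I⁻(V)`, O'Neill Lemma 14.3) and
  `chronologicalPast_closure_subset_of_isPastSet` (`I⁻(closure P) ⊆ P` for a past set `P`, Hawking–Ellis §6.8);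
  hence `exteriorOf_subset_endVisibleRegion_of_subset_closure`: a charted set `U ⊆ closure (endVisibleRegion 𝒟)`
  has its honest exterior `J⁺(ι X) ∩ I⁻(U)` INSIDE the end-visible region (a past set).
* §2 per development: `completeRaysNearEndVisible_of_raysStayInClosure_of_subset_closure` — clause (C) for ANY
  region `O ⊆ closure (endVisibleRegion 𝒟)` already implies NoHidden at `𝒟`; the honest form
  `completeRaysNearEndVisible_of_raysStayInClosure_exteriorOf` (`O = exteriorOf 𝒟 U`, `U ⊆ closure (endVisibleRegion 𝒟)`);
  the contrapositive `not_raysStayInClosure_of_not_completeRaysNearEndVisible` — ON A DEVELOPMENT CARRYING A HIDDEN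
  FUTURE-COMPLETE RAY FROM `Σ`, NO WITNESS REGION INSIDE THE CLOSED END-VISIBLE REGION SATISFIES CLAUSE (C) (the typed
  form of finding §3 of `Cruxes/DriftCapture/Lines/birth-lead-c3.md`: on pocketed data tracked at every accuracy in the
  AF exterior the crux as typed is decided by N); and `raysStayInClosure_exteriorOf_iff_completeRaysNearEndVisible`:
  under S at `U` and the dual chart-side inclusion S′ `U ⊆ closure (endVisibleRegion 𝒟)` ("the end sees the charts"),
  clause (C) at `exteriorOf 𝒟 U` is EQUIVALENT to NoHidden at `𝒟`.
* §3 ∀-level: `noHiddenCompleteRays_of_settledExteriorHoldsRays_of_endVisibleCharts` — the body of item 17673 together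
  with "every censored MGHD that settles honestly settles honestly with end-visible charts" implies the registered
  signature of `stub_noHiddenCompleteRays` verbatim (the converse companion of
  `DarkFuture.endVisibleShadow_of_settledExteriorHoldsRays`). So a summit ruling Q-F1 that keeps clause (C) verbatim
  keeps N on every datum whose MGHDs settle with end-visible charts; restricting (C) to end-visible rays
  (`EndVisible.EndVisibleRaysStayInClosure`) is the only typed option under which N leaves the summit.
* §4 `censorN_of_censorAtEndVisibleCharts` — the per-development statement of §2 under its registered sub-goal name.

Nothing here restates a route item; the stub itself stays open. References: O'Neill 1983, Ch. 14, Lemma 14.3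
(p. 403) and p. 402; Hawking–Ellis 1973, §6.8 (past sets), §9.2; Dafermos–Luk arXiv:1710.01722, Conjecture 1 and
p. 10 (no interior claim).
-/

noncomputable section

-- the doubled `FinalStateConjecture.FinalStateConjecture` path component trips dupNamespace
set_option linter.dupNamespace false

open Set Filter Topology
open scoped Manifold ContDiff
open Literature.Geometry.Lorentzian
open Summit.FinalStateConjecture.FinalStateConjecture.Theorems

namespace Summit.FinalStateConjecture.FinalStateConjecture.Theorems.RenormalisedDrift.DriftCapture

/-! ## §1. Past sets swallow the chronological past of their closure -/

section PerDevelopment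

variable {X : Type} [TopologicalSpace X] [ChartedSpace E3 X] [IsManifold (𝓡 3) ∞ X]
  [ConnectedSpace X] {D : InitialDataSet (𝓡 3) X} {𝒟 : CauchyDevelopment D}

/-- **`I⁻(closure V) ⊆ I⁻(V)`** on the carrier of a Cauchy development: if `q ≪ u` with `u ∈ closure V`,
the open set `I⁺(q) ∋ u` (manifold without boundary) meets `V` in some `v`, and `q ≪ v`.
[cite: ONeillSemiRiemannian1983, Ch. 14, Lemma 14.3 (p. 403)] -/
theorem chronologicalPast_closure_subset_chronologicalPast (V : Set 𝒟.carrier) :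
    𝒟.metric.chronologicalPast 𝒟.timeOrientation (closure V) ⊆
      𝒟.metric.chronologicalPast 𝒟.timeOrientation V := by
  -- adapted from `Theorems.chronologicalPast_closure_subset` (ClusterCompleteness…TransferCofinal)
  intro q hq
  obtain ⟨u, huV, huq⟩ :=
    (LorentzianMetric.mem_chronologicalPast_iff_exists (g := 𝒟.metric) (τ := 𝒟.timeOrientation)).1 hq
  obtain ⟨v, hvq, hvV⟩ := mem_closure_iff.1 huV _
    (LorentzianMetric.isOpen_chronologicalFuture_of_boundaryless 𝒟.metric 𝒟.timeOrientation {q}) huq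
  exact (LorentzianMetric.mem_chronologicalPast_iff_exists (g := 𝒟.metric) (τ := 𝒟.timeOrientation)).2
    ⟨v, hvV, hvq⟩

/-- **A past set swallows the chronological past of its closure**: `I⁻(P) ⊆ P` gives `I⁻(closure P) ⊆ P`.
[cite: HawkingEllis1973, §6.8] -/
theorem chronologicalPast_closure_subset_of_isPastSet {P : Set 𝒟.carrier}
    (hP : 𝒟.metric.IsPastSet 𝒟.timeOrientation P) :
    𝒟.metric.chronologicalPast 𝒟.timeOrientation (closure P) ⊆ P :=
  (chronologicalPast_closure_subset_chronologicalPast P).trans hP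

/-- **A charted set seen by the end has an end-visible honest exterior**: if `U ⊆ closure (endVisibleRegion 𝒟)`
then `exteriorOf 𝒟 U = J⁺(ι X) ∩ I⁻(U) ⊆ endVisibleRegion 𝒟` (the end-visible region is a past set,
`EndVisible.isPastSet_endVisibleRegion`). [cite: HawkingEllis1973, §6.8] -/
theorem exteriorOf_subset_endVisibleRegion_of_subset_closure [𝒟.metric.HasLeviCivita]
    {U : Set 𝒟.carrier} (hU : U ⊆ closure (EndVisible.endVisibleRegion 𝒟)) :
    _root_.Summit.FinalStateConjecture.exteriorOf 𝒟 U ⊆ EndVisible.endVisibleRegion 𝒟 :=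
  fun _ hq ↦ chronologicalPast_closure_subset_of_isPastSet EndVisible.isPastSet_endVisibleRegion
    (LorentzianMetric.chronologicalPast_mono hU hq.2)

/-! ## §2. Per development: clause (C) on an end-visible witness forces NoHidden -/

/-- **Clause (C) for ANY witness region inside the closed end-visible region implies NoHidden.** If every
future-complete normalised null ray from `Σ` stays in `closure O` and `O ⊆ closure (endVisibleRegion 𝒟)`, then
every such ray stays in `closure (endVisibleRegion 𝒟)`, i.e. `CompleteRaysNearEndVisible 𝒟`.
[cite: DafermosLuk2017, Conjecture 1] -/
theorem completeRaysNearEndVisible_of_raysStayInClosure_of_subset_closure {O : Set 𝒟.carrier}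
    (hC : _root_.Summit.FinalStateConjecture.RaysStayInClosure 𝒟 O)
    (hO : ∀ [𝒟.metric.HasLeviCivita], O ⊆ closure (EndVisible.endVisibleRegion 𝒟)) :
    EndVisible.CompleteRaysNearEndVisible 𝒟 := by
  intro _ p γ dom hγ hdom t ht ht0
  have h := closure_mono hO (hC p γ dom hγ hdom t ht ht0)
  rwa [closure_closure] at h

/-- **Clause (C) for an honest exterior whose charts the end sees implies NoHidden**: if
`RaysStayInClosure 𝒟 (exteriorOf 𝒟 U)` and `U ⊆ closure (endVisibleRegion 𝒟)`, then
`CompleteRaysNearEndVisible 𝒟` — (C) puts the outer region into `J⁺(ι X) ∩ I⁻(U)`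
(`EndVisible.outerRegion_subset_exteriorOf_of_raysStayInClosure`, push-up through the open `I⁺(q)`), which lies in
the past set `endVisibleRegion 𝒟` (§1), and NoHidden is `outerRegion ⊆ endVisibleRegion`
(`EndVisible.completeRaysNearEndVisible_iff_outerRegion_subset`). [cite: ONeillSemiRiemannian1983, Ch. 14, Lemma 14.3 (p. 403)] -/
theorem completeRaysNearEndVisible_of_raysStayInClosure_exteriorOf (U : Set 𝒟.carrier)
    (hC : _root_.Summit.FinalStateConjecture.RaysStayInClosure 𝒟
      (_root_.Summit.FinalStateConjecture.exteriorOf 𝒟 U))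
    (hU : ∀ [𝒟.metric.HasLeviCivita], U ⊆ closure (EndVisible.endVisibleRegion 𝒟)) :
    EndVisible.CompleteRaysNearEndVisible 𝒟 :=
  EndVisible.completeRaysNearEndVisible_iff_outerRegion_subset.2 fun {_} ↦
    (EndVisible.outerRegion_subset_exteriorOf_of_raysStayInClosure U hC).trans
      (exteriorOf_subset_endVisibleRegion_of_subset_closure hU)

/-- **A hidden future-complete ray defeats clause (C) for every witness the end can see.** If NoHidden fails at
`𝒟` (some point `γ t`, `t ≥ 0`, of some future-complete normalised null ray from `Σ` lies outside
`closure (endVisibleRegion 𝒟)`), then NO region `O ⊆ closure (endVisibleRegion 𝒟)` satisfies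
`RaysStayInClosure 𝒟 O`; in particular no honest `O = exteriorOf 𝒟 U` with `U ⊆ closure (endVisibleRegion 𝒟)`.
(On pocketed data `X = ℝ³ # (ℍ³/Γ)` with a complete hidden pocket ray — if such an MGHD exists — every decomposition
charting the asymptotically flat exterior is of this kind, so the crux as typed is decided there by N alone.)
[cite: DafermosLuk2017, Conjecture 1] -/
theorem not_raysStayInClosure_of_not_completeRaysNearEndVisible
    (hN : ¬ EndVisible.CompleteRaysNearEndVisible 𝒟) {O : Set 𝒟.carrier}
    (hO : ∀ [𝒟.metric.HasLeviCivita], O ⊆ closure (EndVisible.endVisibleRegion 𝒟)) :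
    ¬ _root_.Summit.FinalStateConjecture.RaysStayInClosure 𝒟 O :=
  fun hC ↦ hN (completeRaysNearEndVisible_of_raysStayInClosure_of_subset_closure hC @hO)

/-- **Under both chart-side inclusions, clause (C) IS NoHidden.** If the end-visible region to the causal future of
the data lies in `exteriorOf 𝒟 U` (S at `U`: what the end sees is below the charts) and
`U ⊆ closure (endVisibleRegion 𝒟)` (S′ at `U`: the end sees the charts), then
`RaysStayInClosure 𝒟 (exteriorOf 𝒟 U) ↔ CompleteRaysNearEndVisible 𝒟`. (`⇒`:
`completeRaysNearEndVisible_of_raysStayInClosure_exteriorOf`; `⇐`: N in set form, S, outer-region adherence,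
`EndVisible.raysStayInClosure_of_outerRegion_subset_closure`.) [cite: HawkingEllis1973, §9.2] -/
theorem raysStayInClosure_exteriorOf_iff_completeRaysNearEndVisible (U : Set 𝒟.carrier)
    (hS : ∀ [𝒟.metric.HasLeviCivita],
      EndVisible.endVisibleRegion 𝒟 ∩ 𝒟.metric.causalFuture 𝒟.timeOrientation (range 𝒟.embed) ⊆
        _root_.Summit.FinalStateConjecture.exteriorOf 𝒟 U)
    (hS' : ∀ [𝒟.metric.HasLeviCivita], U ⊆ closure (EndVisible.endVisibleRegion 𝒟)) :
    _root_.Summit.FinalStateConjecture.RaysStayInClosure 𝒟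
        (_root_.Summit.FinalStateConjecture.exteriorOf 𝒟 U) ↔
      EndVisible.CompleteRaysNearEndVisible 𝒟 :=
  ⟨fun hC ↦ completeRaysNearEndVisible_of_raysStayInClosure_exteriorOf U hC @hS',
    fun hN ↦ EndVisible.raysStayInClosure_of_outerRegion_subset_closure fun {_} _ hq ↦
      subset_closure
        (hS ⟨EndVisible.outerRegion_subset_endVisibleRegion_of_completeRaysNearEndVisible hN hq, hq.1⟩)⟩

end PerDevelopment

/-! ## §3. ∀-level: item 17673 and end-visible honest charts give the registered stub N verbatim -/

/-- **CENSOR ∧ (honest settling can be witnessed by end-visible charts) ⇒ N.** From the body of item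
`SettledExteriorHoldsRays` (stmt-17673; clause (C) for EVERY honest sub-extremal exhaustive future-oriented
`2`-decomposition of every censored MGHD of admissible data) and the chart-side statement "every such MGHD admitting
such a decomposition admits one whose charted late region lies in `closure (endVisibleRegion 𝒟)`" (the hole charts
normalised to the final parameters sit outside the true event horizon, the flat chart in the radiation zone; a chart
dipping inside the horizon at finite times would violate it), the registered signature of `stub_noHiddenCompleteRays`
follows: apply 17673 to the end-visible decomposition and `completeRaysNearEndVisible_of_raysStayInClosure_exteriorOf`.
The converse companion of `DarkFuture.endVisibleShadow_of_settledExteriorHoldsRays` (17673 ⇒ S).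
[cite: DafermosLuk2017, Conjecture 1] -/
theorem noHiddenCompleteRays_of_settledExteriorHoldsRays_of_endVisibleCharts
    (hC : ∀ (X : Type) [TopologicalSpace X] [ChartedSpace E3 X] [IsManifold (𝓡 3) ∞ X] [T2Space X]
      [SecondCountableTopology X] [ConnectedSpace X] (D : InitialDataSet (𝓡 3) X),
      D ∈ admissibleVacuumData X → ∀ 𝒟 : VacuumCauchyDevelopment D, 𝒟.IsMaximal →
      _root_.Summit.FinalStateConjecture.HasCompleteNullInfinity 𝒟.toCauchyDevelopment →
      ∀ (O : Set 𝒟.carrier) (fd : FinalStateDecomposition 𝒟.toSpacetime O 2),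
      (∀ i, Kerr.IsSubextremal (fd.mass i) (fd.spin i)) →
      O = _root_.Summit.FinalStateConjecture.exteriorOf 𝒟.toCauchyDevelopment fd.charted →
      _root_.Summit.FinalStateConjecture.HasExhaustiveCharts fd →
      _root_.Summit.FinalStateConjecture.IsFutureOriented fd →
      _root_.Summit.FinalStateConjecture.RaysStayInClosure 𝒟.toCauchyDevelopment O)
    (hS' : ∀ (X : Type) [TopologicalSpace X] [ChartedSpace E3 X] [IsManifold (𝓡 3) ∞ X] [T2Space X]
      [SecondCountableTopology X] [ConnectedSpace X] (D : InitialDataSet (𝓡 3) X),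
      D ∈ admissibleVacuumData X → ∀ 𝒟 : VacuumCauchyDevelopment D, 𝒟.IsMaximal →
      _root_.Summit.FinalStateConjecture.HasCompleteNullInfinity 𝒟.toCauchyDevelopment →
      (∃ (O : Set 𝒟.carrier) (fd : FinalStateDecomposition 𝒟.toSpacetime O 2),
        (∀ i, Kerr.IsSubextremal (fd.mass i) (fd.spin i)) ∧
        O = _root_.Summit.FinalStateConjecture.exteriorOf 𝒟.toCauchyDevelopment fd.charted ∧
        _root_.Summit.FinalStateConjecture.HasExhaustiveCharts fd ∧
        _root_.Summit.FinalStateConjecture.IsFutureOriented fd) →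
      ∃ (O' : Set 𝒟.carrier) (fd' : FinalStateDecomposition 𝒟.toSpacetime O' 2),
        (∀ i, Kerr.IsSubextremal (fd'.mass i) (fd'.spin i)) ∧
        O' = _root_.Summit.FinalStateConjecture.exteriorOf 𝒟.toCauchyDevelopment fd'.charted ∧
        _root_.Summit.FinalStateConjecture.HasExhaustiveCharts fd' ∧
        _root_.Summit.FinalStateConjecture.IsFutureOriented fd' ∧
        ∀ [𝒟.metric.HasLeviCivita],
          fd'.charted ⊆ closure (EndVisible.endVisibleRegion 𝒟.toCauchyDevelopment)) :
    ∀ (X : Type) [TopologicalSpace X] [ChartedSpace E3 X] [IsManifold (𝓡 3) ∞ X] [T2Space X]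
      [SecondCountableTopology X] [ConnectedSpace X] (D : InitialDataSet (𝓡 3) X),
      D ∈ admissibleVacuumData X → ∀ 𝒟 : VacuumCauchyDevelopment D, 𝒟.IsMaximal →
      _root_.Summit.FinalStateConjecture.HasCompleteNullInfinity 𝒟.toCauchyDevelopment →
      ∀ (O : Set 𝒟.carrier) (fd : FinalStateDecomposition 𝒟.toSpacetime O 2),
      (∀ i, Kerr.IsSubextremal (fd.mass i) (fd.spin i)) →
      O = _root_.Summit.FinalStateConjecture.exteriorOf 𝒟.toCauchyDevelopment fd.charted →
      _root_.Summit.FinalStateConjecture.HasExhaustiveCharts fd →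
      _root_.Summit.FinalStateConjecture.IsFutureOriented fd →
      EndVisible.CompleteRaysNearEndVisible 𝒟.toCauchyDevelopment := by
  intro X _ _ _ _ _ _ D hD 𝒟 hmax hscri O fd hsub hO hexh hfo
  obtain ⟨O', fd', hsub', hO', hexh', hfo', hvis⟩ :=
    hS' X D hD 𝒟 hmax hscri ⟨O, fd, hsub, hO, hexh, hfo⟩
  have hC' : _root_.Summit.FinalStateConjecture.RaysStayInClosure 𝒟.toCauchyDevelopment O' :=
    hC X D hD 𝒟 hmax hscri O' fd' hsub' hO' hexh' hfo'
  rw [hO'] at hC'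
  -- `apply` + `intro`: the instance-quantified `hvis` cannot be passed as a term under the goal's own binder
  apply completeRaysNearEndVisible_of_raysStayInClosure_exteriorOf (𝒟 := 𝒟.toCauchyDevelopment) fd'.charted hC'
  intro _
  exact hvis

/-! ## §4. Registered sub-goal of stmt-FinalStateConjecture-17391 (one-line signature) -/

/-- **Registered sub-goal `censorN_of_censorAtEndVisibleCharts`** (header on one line = the registered signature;
= `completeRaysNearEndVisible_of_raysStayInClosure_exteriorOf`): clause (C) for an honest exterior whose charted set the
end sees implies CENSOR-N at that development. [cite: DafermosLuk2017, Conjecture 1] -/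
theorem censorN_of_censorAtEndVisibleCharts : open Literature.Geometry.Lorentzian Summit.FinalStateConjecture.FinalStateConjecture.Theorems in open scoped Manifold ContDiff in ∀ {X : Type} [TopologicalSpace X] [ChartedSpace E3 X] [IsManifold (𝓡 3) ∞ X] [ConnectedSpace X] {D : InitialDataSet (𝓡 3) X} {𝒟 : CauchyDevelopment D} (U : Set 𝒟.carrier), Summit.FinalStateConjecture.RaysStayInClosure 𝒟 (Summit.FinalStateConjecture.exteriorOf 𝒟 U) → (∀ [𝒟.metric.HasLeviCivita], U ⊆ closure (EndVisible.endVisibleRegion 𝒟)) → EndVisible.CompleteRaysNearEndVisible 𝒟 :=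
  fun U hC hU ↦ completeRaysNearEndVisible_of_raysStayInClosure_exteriorOf U hC @hU

end Summit.FinalStateConjecture.FinalStateConjecture.Theorems.RenormalisedDrift.DriftCapture

end
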